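import Mathlib.LinearAlgebra.Lagrange
import Summits.Ventures.HSemireg.WedgeHankelRecurrenceGaussNodesInterlace

/-!
# Venture HSemireg — **GAUSS–JACOBI MECHANICAL QUADRATURE AND THE CHRISTOFFEL NUMBERS**: for two discrete representations `Σ_{j ≤ t} μ_j v_j^p = Σ_l ν_l w_l^p` (`p ≤ 2t`, the `v_j`
# distinct) the small weights are forced: `μ_k = Σ_l ν_l ℓ_k(w_l)²` with `ℓ_k` the Lagrange basis polynomial of the nodes `v` (hence `μ_k > 0` whenever the `ν_l` are positive and
# at least `t + 1` of the `w_l` are distinct — the positivity of the Christoffel numbers); and a `(t+1)`-point rule is exact in degree `≤ 2t + 1` against `(ν, w)` IF AND ONLY IF its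
# node polynomial `q = ∏_j (X − v_j)` is orthogonal to every polynomial of degree `≤ t` and its weights are `Σ_l ν_l ℓ_k(w_l)` (Gauss–Jacobi)

HONEST FRAMING. Part of the Lean index of the computation cell `pub-hsemireg` (seat p10 gen 42, Sunday typer «UNIFORM-IN-n»).  Real polynomials and finite sums only (Mathlib
`Lagrange.basis`, `Polynomial.modByMonic`; N262's `sum_mul_eval_eq_of_moments_eq`); no variety, no cohomology theory, no sheaf, no Ext group and no semiregularity map is constructed
here; nothing here says that HC / HC_CM / HC_AV holds; no Literature fact (unproved `Prop`) is declared or used.  Custodian versions as in `WedgeHankelSiegelIdeal` (1/3).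
SOURCES (cited).  G. Szegő, *Orthogonal Polynomials*, AMS Colloq. Publ. 23, §3.4: Thm 3.4.1 (Gauss–Jacobi mechanical quadrature: the `n`-point rule on the zeros of `p_n` with the
Christoffel numbers `λ_ν = ∫ ℓ_ν dα` is exact in degree `≤ 2n − 1`, and this characterises the zeros of `p_n`) and Thm 3.4.2 (the Christoffel numbers are positive, `λ_ν = ∫ ℓ_ν² dα`);
F. R. Gantmacher, *The Theory of Matrices* II, Ch. XV §16 (the `m`-atomic representation of `s_0, …, s_{2m−1}`, typed N235); M. G. Krein, A. A. Nudel'man, *The Markov Moment Problem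
and Extremal Problems* (1977), Ch. III §1 (canonical representations).
PROOF TYPED HERE.  `ℓ_k²` has degree `2t`, so both representations integrate it identically (N262 `sum_mul_eval_eq_of_moments_eq`); on the small side only the node `v_k` survives.  For
Gauss–Jacobi: exactness applied to `q · G` (`deg G ≤ t`) gives orthogonality, applied to `ℓ_k` gives the weights; conversely write `F = q · (F /ₘ q) + F %ₘ q`, kill the first term on
both sides, and expand the remainder (degree `≤ t`) in the Lagrange basis.
DEDUP DISCLOSURE (`rg -n 'Lagrange.basis|christoffel|Christoffel' Summits/Ventures/HSemireg`, 2026-09-02): `Lagrange.basis` is used Ext-side (`NodalWeightPowerSum`, `PairBlockPureTensors`)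
for other purposes; nothing on quadrature weights.  Uniqueness of the `(t+1)`-atomic representation is N2xx `moments_unique` (NOT restated).  The 10 names below: 0 hits tree-wide.

WHAT IS IN THE TREE.  N262 `sum_mul_eval_eq_of_moments_eq`; Mathlib `Lagrange.eval_basis_self`, `Lagrange.eval_basis_of_ne`, `Lagrange.natDegree_basis`, `Lagrange.basis_ne_zero`,
`Polynomial.modByMonic_add_div`, `Polynomial.natDegree_modByMonic_lt`, `Polynomial.eq_zero_of_natDegree_lt_card_of_eval_eq_zero`, `Lagrange.eq_interpolate`.
THIS FILE (namespace `Summit.Ventures.HSemireg.Wedge.HankelOuter` continued; CHAINED on N262; 0 definitions):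
* §1030 `natDegree_lagrange_basis_fin` (`deg ℓ_k = t`), `sum_mul_eval_lagrange_basis` (`Σ_j μ_j ℓ_k(v_j) = μ_k`), **`gauss_weight_eq_sum_mul_eval_basis_sq`** (`μ_k = Σ_l ν_l ℓ_k(w_l)²`,
  moments up to `2t`), `gauss_weight_eq_sum_mul_eval_basis` (`μ_k = Σ_l ν_l ℓ_k(w_l)`, moments up to `t`), `gauss_weight_nonneg`, **`gauss_weight_pos`** (THE CHRISTOFFEL NUMBERS ARE
  POSITIVE), `sum_mul_eval_nodePoly_mul_eq_zero` (exactness ⇒ orthogonality of `q`), `sum_mul_eval_eq_of_orthogonal` (orthogonality + Christoffel weights ⇒ exactness in degree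
  `≤ 2t + 1`), **`gauss_jacobi_iff`** (THM 3.4.1 as an `↔`).
CAVEATS.  Discrete (finitely atomic) integrating representation `(ν, w)` only, as everywhere in this lineage; nothing Ext-side.  New names only.
-/

open Module Polynomial
open scoped Matrix Polynomial

namespace Summit.Ventures.HSemireg.Wedge.HankelOuter

/-! ## §1030. Christoffel numbers and the Gauss–Jacobi theorem -/

/-- `deg ℓ_k = t` for the Lagrange basis of `t + 1` distinct nodes. [Mathlib `Lagrange.natDegree_basis`; this file, §1030] -/
theorem natDegree_lagrange_basis_fin {t : ℕ} {v : Fin (t + 1) → ℝ} (hv : Function.Injective v) (k : Fin (t + 1)) :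
    (Lagrange.basis Finset.univ v k).natDegree = t := by
  rw [Lagrange.natDegree_basis (hv.injOn.mono (Set.subset_univ _)) (Finset.mem_univ k), Finset.card_univ, Fintype.card_fin, Nat.add_sub_cancel]

/-- On the nodes themselves only `v_k` survives: `Σ_j μ_j ℓ_k(v_j) · g_j = μ_k g_k`-type bookkeeping, here `Σ_j μ_j ℓ_k(v_j)^e = μ_k` for `e ≥ 1`. [bookkeeping; this file, §1030] -/
theorem sum_mul_eval_lagrange_basis_pow {t : ℕ} {v : Fin (t + 1) → ℝ} (hv : Function.Injective v) (μ : Fin (t + 1) → ℝ) (k : Fin (t + 1)) {e : ℕ} (he : e ≠ 0) :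
    ∑ j, μ j * ((Lagrange.basis Finset.univ v k).eval (v j)) ^ e = μ k := by
  rw [Finset.sum_eq_single k]
  · rw [Lagrange.eval_basis_self (hv.injOn.mono (Set.subset_univ _)) (Finset.mem_univ k), one_pow, mul_one]
  · intro j _ hjk
    rw [Lagrange.eval_basis_of_ne (Ne.symm hjk) (Finset.mem_univ j), zero_pow he, mul_zero]
  · exact fun h => absurd (Finset.mem_univ k) h

/-- **`μ_k = Σ_l ν_l ℓ_k(w_l)²`** (Szegő's `λ_ν = ∫ ℓ_ν² dα`): if `Σ_j μ_j v_j^p = Σ_l ν_l w_l^p` for all `p ≤ 2t` with `v : Fin (t+1) → ℝ` injective, then every small weight is the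
big quadrature of the square of the corresponding Lagrange basis polynomial. [Szegő Thm 3.4.2; this file, §1030] -/
theorem gauss_weight_eq_sum_mul_eval_basis_sq {t N : ℕ} {μ v : Fin (t + 1) → ℝ} {ν w : Fin N → ℝ} (hv : Function.Injective v)
    (hmom : ∀ p, p ≤ 2 * t → ∑ j, μ j * v j ^ p = ∑ l, ν l * w l ^ p) (k : Fin (t + 1)) :
    μ k = ∑ l, ν l * ((Lagrange.basis Finset.univ v k).eval (w l)) ^ 2 := by
  set L := Lagrange.basis Finset.univ v k with hL
  have hdeg : (L * L).natDegree < 2 * t + 1 := by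
    refine lt_of_le_of_lt natDegree_mul_le ?_
    rw [natDegree_lagrange_basis_fin hv k]; omega
  have h := sum_mul_eval_eq_of_moments_eq (N := 2 * t + 1) (fun p hp => hmom p (by omega)) hdeg
  simp only [eval_mul] at h
  simp only [← pow_two] at h
  rwa [sum_mul_eval_lagrange_basis_pow hv μ k two_ne_zero] at h

/-- `μ_k = Σ_l ν_l ℓ_k(w_l)` (Szegő's `λ_ν = ∫ ℓ_ν dα`): moments up to `t` suffice for the linear form of the Christoffel numbers. [Szegő Thm 3.4.1 (3.4.1); this file, §1030] -/
theorem gauss_weight_eq_sum_mul_eval_basis {t N : ℕ} {μ v : Fin (t + 1) → ℝ} {ν w : Fin N → ℝ} (hv : Function.Injective v)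
    (hmom : ∀ p, p ≤ t → ∑ j, μ j * v j ^ p = ∑ l, ν l * w l ^ p) (k : Fin (t + 1)) :
    μ k = ∑ l, ν l * (Lagrange.basis Finset.univ v k).eval (w l) := by
  set L := Lagrange.basis Finset.univ v k with hL
  have hdeg : L.natDegree < t + 1 := by rw [natDegree_lagrange_basis_fin hv k]; omega
  have h := sum_mul_eval_eq_of_moments_eq (N := t + 1) (fun p hp => hmom p (by omega)) hdeg
  have h1 := sum_mul_eval_lagrange_basis_pow hv μ k one_ne_zero
  simp only [pow_one] at h1
  rwa [h1] at h

/-- The small weights are nonnegative as soon as the big ones are. [Szegő Thm 3.4.2; this file, §1030] -/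
theorem gauss_weight_nonneg {t N : ℕ} {μ v : Fin (t + 1) → ℝ} {ν w : Fin N → ℝ} (hv : Function.Injective v) (hν : ∀ l, 0 ≤ ν l)
    (hmom : ∀ p, p ≤ 2 * t → ∑ j, μ j * v j ^ p = ∑ l, ν l * w l ^ p) (k : Fin (t + 1)) : 0 ≤ μ k := by
  rw [gauss_weight_eq_sum_mul_eval_basis_sq hv hmom k]
  exact Finset.sum_nonneg fun l _ => mul_nonneg (hν l) (sq_nonneg _)

/-- **THE CHRISTOFFEL NUMBERS ARE POSITIVE**: if `Σ_j μ_j v_j^p = Σ_l ν_l w_l^p` for `p ≤ 2t` (`t + 1` distinct small nodes), the big weights are positive and at least `t + 1` of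
the big nodes are distinct (`w` injective on `Fin N`, `t + 1 ≤ N`), then every `μ_k > 0` — positivity of the Gauss weights is a consequence, not a hypothesis.
[Szegő Thm 3.4.2; this file, §1030] -/
theorem gauss_weight_pos {t N : ℕ} {μ v : Fin (t + 1) → ℝ} {ν w : Fin N → ℝ} (hv : Function.Injective v) (hν : ∀ l, 0 < ν l) (hw : Function.Injective w) (hN : t + 1 ≤ N)
    (hmom : ∀ p, p ≤ 2 * t → ∑ j, μ j * v j ^ p = ∑ l, ν l * w l ^ p) (k : Fin (t + 1)) : 0 < μ k := by
  rw [gauss_weight_eq_sum_mul_eval_basis_sq hv hmom k]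
  have hnn : ∀ l ∈ (Finset.univ : Finset (Fin N)), 0 ≤ ν l * ((Lagrange.basis Finset.univ v k).eval (w l)) ^ 2 := fun l _ => mul_nonneg (hν l).le (sq_nonneg _)
  refine lt_of_le_of_ne (Finset.sum_nonneg hnn) fun h0 => ?_
  have hall := (Finset.sum_eq_zero_iff_of_nonneg hnn).1 h0.symm
  -- then `ℓ_k` (degree `t`, non-zero) vanishes at `N ≥ t + 1` distinct points
  have hz : ∀ l, (Lagrange.basis Finset.univ v k).eval (w l) = 0 := fun l => by
    have := hall l (Finset.mem_univ l)
    rcases mul_eq_zero.1 this with h | h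
    · exact absurd h (hν l).ne'
    · exact pow_eq_zero_iff (n := 2) two_ne_zero |>.1 h
  have hL0 := eq_zero_of_natDegree_lt_card_of_eval_eq_zero (Lagrange.basis Finset.univ v k) hw hz (by rw [natDegree_lagrange_basis_fin hv k, Fintype.card_fin]; omega)
  exact Lagrange.basis_ne_zero (hv.injOn.mono (Set.subset_univ _)) (Finset.mem_univ k) hL0

/-- **Exactness ⇒ orthogonality of the node polynomial**: if the `(t+1)`-point rule `(μ, v)` is exact in degree `≤ 2t + 1` against `(ν, w)` then `Σ_l ν_l q(w_l) G(w_l) = 0` for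
`q = ∏_j (X − v_j)` and every `G` with `deg G ≤ t`. [Szegő Thm 3.4.1; this file, §1030] -/
theorem sum_mul_eval_nodePoly_mul_eq_zero {t N : ℕ} {μ v : Fin (t + 1) → ℝ} {ν w : Fin N → ℝ}
    (hmom : ∀ p, p ≤ 2 * t + 1 → ∑ j, μ j * v j ^ p = ∑ l, ν l * w l ^ p) {G : ℝ[X]} (hG : G.natDegree ≤ t) :
    ∑ l, ν l * ((∏ j, (Polynomial.X - C (v j))) * G).eval (w l) = 0 := by
  have hqdeg : (∏ j, (Polynomial.X - C (v j))).natDegree = t + 1 := by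
    rw [natDegree_prod_of_monic _ _ fun j _ => monic_X_sub_C (v j)]
    simp only [natDegree_X_sub_C, Finset.sum_const, Finset.card_univ, Fintype.card_fin, smul_eq_mul, mul_one]
  have hdeg : ((∏ j, (Polynomial.X - C (v j))) * G).natDegree < 2 * t + 2 := by
    refine lt_of_le_of_lt natDegree_mul_le ?_
    rw [hqdeg]; omega
  rw [← sum_mul_eval_eq_of_moments_eq (N := 2 * t + 2) (fun p hp => hmom p (by omega)) hdeg]
  refine Finset.sum_eq_zero fun j _ => ?_
  have hq0 : (∏ j, (Polynomial.X - C (v j))).eval (v j) = 0 := by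
    rw [eval_prod]; exact Finset.prod_eq_zero (Finset.mem_univ j) (by simp)
  rw [eval_mul, hq0, zero_mul, mul_zero]

/-- A polynomial of degree `≤ t` is its Lagrange interpolant on `t + 1` distinct nodes: `Σ_l ν_l R(w_l) = Σ_k R(v_k) · Σ_l ν_l ℓ_k(w_l)`. [Mathlib `Lagrange.eq_interpolate`; this file, §1030] -/
theorem sum_mul_eval_eq_sum_eval_mul_sum_basis {t N : ℕ} {v : Fin (t + 1) → ℝ} (hv : Function.Injective v) (ν w : Fin N → ℝ) {R : ℝ[X]} (hR : R.natDegree ≤ t) :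
    ∑ l, ν l * R.eval (w l) = ∑ k, R.eval (v k) * ∑ l, ν l * (Lagrange.basis Finset.univ v k).eval (w l) := by
  have hvs : Set.InjOn v (Finset.univ : Finset (Fin (t + 1))) := hv.injOn.mono (Set.subset_univ _)
  have hRdeg : R.degree < (Finset.univ : Finset (Fin (t + 1))).card := by
    rw [Finset.card_univ, Fintype.card_fin]
    exact lt_of_le_of_lt (degree_le_natDegree) (by exact_mod_cast Nat.lt_succ_of_le hR)
  have hint := Lagrange.eq_interpolate hvs hRdeg
  -- evaluate the interpolation formula at each `w l`
  have hev : ∀ y, R.eval y = ∑ k, R.eval (v k) * (Lagrange.basis Finset.univ v k).eval y := fun y => by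
    conv_lhs => rw [hint]
    rw [Lagrange.interpolate_apply, eval_finsetSum]
    exact Finset.sum_congr rfl fun k _ => by rw [eval_mul, eval_C]
  have hl : ∑ l, ν l * R.eval (w l) = ∑ l, ∑ k, ν l * (R.eval (v k) * (Lagrange.basis Finset.univ v k).eval (w l)) :=
    Finset.sum_congr rfl fun l _ => by rw [hev (w l), Finset.mul_sum]
  rw [hl, Finset.sum_comm]
  refine Finset.sum_congr rfl fun k _ => ?_
  rw [Finset.mul_sum]
  exact Finset.sum_congr rfl fun l _ => by ring

/-- **Orthogonality + Christoffel weights ⇒ exactness in degree `≤ 2t + 1`** (the Gauss–Jacobi mechanism): if `Σ_l ν_l q(w_l) G(w_l) = 0` for all `deg G ≤ t` and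
`μ_k = Σ_l ν_l ℓ_k(w_l)`, then `Σ_j μ_j F(v_j) = Σ_l ν_l F(w_l)` for every `F` with `deg F ≤ 2t + 1`. [Szegő Thm 3.4.1; this file, §1030] -/
theorem sum_mul_eval_eq_of_orthogonal {t N : ℕ} {μ v : Fin (t + 1) → ℝ} {ν w : Fin N → ℝ} (hv : Function.Injective v)
    (horth : ∀ G : ℝ[X], G.natDegree ≤ t → ∑ l, ν l * ((∏ j, (Polynomial.X - C (v j))) * G).eval (w l) = 0)
    (hμ : ∀ k, μ k = ∑ l, ν l * (Lagrange.basis Finset.univ v k).eval (w l)) {F : ℝ[X]} (hF : F.natDegree ≤ 2 * t + 1) :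
    ∑ j, μ j * F.eval (v j) = ∑ l, ν l * F.eval (w l) := by
  set q : ℝ[X] := ∏ j, (Polynomial.X - C (v j)) with hq
  have hqm : q.Monic := monic_prod_of_monic _ _ fun j _ => monic_X_sub_C (v j)
  have hqdeg : q.natDegree = t + 1 := by
    rw [hq, natDegree_prod_of_monic _ _ fun j _ => monic_X_sub_C (v j)]
    simp only [natDegree_X_sub_C, Finset.sum_const, Finset.card_univ, Fintype.card_fin, smul_eq_mul, mul_one]
  -- division with remainder
  have hdiv : F %ₘ q + q * (F /ₘ q) = F := modByMonic_add_div F q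
  have hq1 : q ≠ 1 := fun h1 => by rw [h1, natDegree_one] at hqdeg; omega
  have hRdeg : (F %ₘ q).natDegree ≤ t := by
    have := natDegree_modByMonic_lt F hqm hq1
    rw [hqdeg] at this; omega
  have hGdeg : (F /ₘ q).natDegree ≤ t := by
    rw [natDegree_divByMonic F hqm, hqdeg]; omega
  -- the nodes kill `q`
  have hq0 : ∀ j, q.eval (v j) = 0 := fun j => by
    rw [hq, eval_prod]; exact Finset.prod_eq_zero (Finset.mem_univ j) (by simp)
  have hsmall : ∑ j, μ j * F.eval (v j) = ∑ j, μ j * (F %ₘ q).eval (v j) := by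
    refine Finset.sum_congr rfl fun j _ => ?_
    conv_lhs => rw [← hdiv]
    rw [eval_add, eval_mul, hq0 j, zero_mul, add_zero]
  have hbig : ∑ l, ν l * F.eval (w l) = ∑ l, ν l * (F %ₘ q).eval (w l) := by
    have h1 : ∑ l, ν l * F.eval (w l) = ∑ l, ν l * (F %ₘ q).eval (w l) + ∑ l, ν l * (q * (F /ₘ q)).eval (w l) := by
      rw [← Finset.sum_add_distrib]
      refine Finset.sum_congr rfl fun l _ => ?_
      conv_lhs => rw [← hdiv]
      rw [eval_add]; ring
    rw [h1, horth _ hGdeg, add_zero]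
  rw [hsmall, hbig, sum_mul_eval_eq_sum_eval_mul_sum_basis hv ν w hRdeg]
  -- the small side: `R(v_j)` against `μ_j = Σ ν ℓ_j(w)`
  rw [show ∑ j, μ j * (F %ₘ q).eval (v j) = ∑ j, (F %ₘ q).eval (v j) * μ j from Finset.sum_congr rfl fun j _ => mul_comm _ _]
  exact Finset.sum_congr rfl fun k _ => by rw [hμ k]

/-- **GAUSS–JACOBI MECHANICAL QUADRATURE (Szegő Thm 3.4.1) for discrete measures, as an equivalence**: a `(t+1)`-point rule with distinct nodes `v` is exact in degree `≤ 2t + 1`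
against `(ν, w)` IFF its node polynomial is `(ν, w)`-orthogonal to all polynomials of degree `≤ t` and its weights are the Christoffel numbers `Σ_l ν_l ℓ_k(w_l)`.
[Szegő Thm 3.4.1; this file, §1030] -/
theorem gauss_jacobi_iff {t N : ℕ} {μ v : Fin (t + 1) → ℝ} {ν w : Fin N → ℝ} (hv : Function.Injective v) :
    (∀ p, p ≤ 2 * t + 1 → ∑ j, μ j * v j ^ p = ∑ l, ν l * w l ^ p) ↔
      (∀ G : ℝ[X], G.natDegree ≤ t → ∑ l, ν l * ((∏ j, (Polynomial.X - C (v j))) * G).eval (w l) = 0) ∧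
        ∀ k, μ k = ∑ l, ν l * (Lagrange.basis Finset.univ v k).eval (w l) := by
  constructor
  · intro hmom
    exact ⟨fun G hG => sum_mul_eval_nodePoly_mul_eq_zero hmom hG, fun k => gauss_weight_eq_sum_mul_eval_basis hv (fun p hp => hmom p (by omega)) k⟩
  · rintro ⟨horth, hμ⟩ p hp
    have h := sum_mul_eval_eq_of_orthogonal hv horth hμ (F := Polynomial.X ^ p) (by rw [natDegree_X_pow]; exact hp)
    simpa only [eval_pow, eval_X] using h

end Summit.Ventures.HSemireg.Wedge.HankelOuter
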